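import Mathlib
import HarnessLib
import Summits.NavierStokesRegularity.NavierStokesRegularity.Theorems.UnthreadedRigidityDoorUnthreadedRigidityVirialHornTwoChannelPlateauKernel

/-!
# Route `UnthreadedRigidityDoor`, item `UnthreadedRigidity` (W2, stmt-NavierStokesRegularity-27585) — LINE g11-1 «VIRIAL HORN»,
# BRIDGE V BY NAME («PLATEAU PROPAGATION»), file 11: POWER SUMS, AND THE CASCADE DATA ON A PLATEAU AS POWER SUMS

Prover file (W2 Lean hand ns-crc-p1 g10, by lineage; `--supports stmt-NavierStokesRegularity-27585 --as helper`; objects BY NAME in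
`Theorems/UnthreadedRigidityDoorUnthreadedRigidityVirialHornTwoChannelDefs.lean`, p726708 / p728780 and its second append).

Content: the algebra of finite integer power sums `powSum` (sums, scalar multiples, products, shifts by `r^z`; existential closure
lemmas), ★ `exists_eulerL_kill_of_powSum` (a power sum on an open `J ⊆ (0,∞)` is killed by an integer Euler product), ★ `plateau_form`
(where `K ≡ 0` on `(a,b)`, `a > 0`: `H = A + B r^{−2l−1}` with its two derivatives, explicitly), `plateau_powSums`, `plateau_jet_powSums`,
★ `plateau_channels_powSums` (`chanY(r²)`, `chanG(r²)`, `ampA(r²)²` are power sums on the plateau — via the scaled identities of file 4a),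
`plateau_cascadeSrc_killed`.
HONEST LABEL: slice-level calculus / real analysis about SPECIAL (separable) data; a piece of the L-part of ONE bridge of a RUNG line on the
wall item; `UnthreadedRigidity` (27585), W2 and NS regularity remain OPEN; nothing here is a statement about Navier–Stokes regularity.  0 kit.
-/

-- the summit and its single sub-problem share the name (CONVENTIONS §1), as in every Theorems file
set_option linter.dupNamespace false

namespace Summit.NavierStokesRegularity.NavierStokesRegularity.Theorems.UnthreadedRigidity.VirialHorn

open scoped RealInnerProductSpace Topology Laplacian
open Filter Set MvPolynomial
open Literature.Combinatorics.LorentzianPolynomials (pderiv_pderiv_comm)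
open Summit.NavierStokesRegularity.NavierStokesRegularity.Theorems.UnthreadedRigidity.ProfileHorn (E3)
open Summit.NavierStokesRegularity.NavierStokesRegularity.Theorems.UnthreadedRigidity.HornPressure (radCoeff)
open Summit.NavierStokesRegularity.NavierStokesRegularity.Theorems.PoloidalLiouville.HorizonTower hiding E3

/-! ## §12 Power sums, and the cascade data ON A PLATEAU as power sums -/

section Plateau

open scoped ContDiff

variable {l : ℕ} {H h : ℝ → ℝ}

/-- `powSum` of a cons. -/
theorem powSum_cons (p : ℝ × ℤ) (L : List (ℝ × ℤ)) (r : ℝ) : powSum (p :: L) r = p.1 * r ^ p.2 + powSum L r := by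
  simp [powSum]

/-- `powSum` of the empty list. -/
theorem powSum_nil (r : ℝ) : powSum [] r = 0 := by simp [powSum]

/-- `powSum` of a concatenation. -/
theorem powSum_append (L₁ L₂ : List (ℝ × ℤ)) (r : ℝ) : powSum (L₁ ++ L₂) r = powSum L₁ r + powSum L₂ r := by
  simp [powSum, List.map_append, List.sum_append]

/-- scalar multiples of power sums are power sums. -/
theorem const_mul_powSum (K : ℝ) (L : List (ℝ × ℤ)) (r : ℝ) :
    K * powSum L r = powSum (L.map fun p => (K * p.1, p.2)) r := by
  induction L with
  | nil => simp [powSum_nil]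
  | cons p L ih => rw [List.map_cons, powSum_cons, powSum_cons, mul_add, ih]; ring

/-- a power sum times `r^z` is a power sum (`r ≠ 0`). -/
theorem powSum_mul_zpow (L : List (ℝ × ℤ)) (z : ℤ) {r : ℝ} (hr : r ≠ 0) :
    powSum L r * r ^ z = powSum (L.map fun p => (p.1, p.2 + z)) r := by
  induction L with
  | nil => simp [powSum_nil]
  | cons p L ih => rw [List.map_cons, powSum_cons, powSum_cons, add_mul, ih, zpow_add₀ hr]; ring

/-- products of power sums are power sums (`r ≠ 0`). -/
theorem powSum_mul (L₁ L₂ : List (ℝ × ℤ)) {r : ℝ} (hr : r ≠ 0) :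
    powSum L₁ r * powSum L₂ r = powSum (L₁.flatMap fun p => L₂.map fun q => (p.1 * q.1, q.2 + p.2)) r := by
  induction L₁ with
  | nil => simp [powSum_nil]
  | cons p L₁ ih =>
    rw [powSum_cons, add_mul, ih, List.flatMap_cons, powSum_append]
    congr 1
    rw [mul_assoc, mul_comm (r ^ p.2), ← mul_assoc, const_mul_powSum, powSum_mul_zpow _ _ hr, List.map_map]
    rfl

/-- EXISTENTIAL CLOSURE: sums. -/
theorem exists_powSum_add {J : Set ℝ} {f g : ℝ → ℝ} (hf : ∃ L, ∀ r ∈ J, f r = powSum L r) (hg : ∃ L, ∀ r ∈ J, g r = powSum L r) :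
    ∃ L, ∀ r ∈ J, f r + g r = powSum L r := by
  obtain ⟨L₁, h₁⟩ := hf; obtain ⟨L₂, h₂⟩ := hg
  exact ⟨L₁ ++ L₂, fun r hr => by rw [powSum_append, h₁ r hr, h₂ r hr]⟩

/-- EXISTENTIAL CLOSURE: differences. -/
theorem exists_powSum_sub {J : Set ℝ} {f g : ℝ → ℝ} (hf : ∃ L, ∀ r ∈ J, f r = powSum L r) (hg : ∃ L, ∀ r ∈ J, g r = powSum L r) :
    ∃ L, ∀ r ∈ J, f r - g r = powSum L r := by
  obtain ⟨L₁, h₁⟩ := hf; obtain ⟨L₂, h₂⟩ := hg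
  refine ⟨L₁ ++ L₂.map fun p => ((-1 : ℝ) * p.1, p.2), fun r hr => ?_⟩
  rw [powSum_append, ← const_mul_powSum, h₁ r hr, h₂ r hr]; ring

/-- EXISTENTIAL CLOSURE: scalar multiples. -/
theorem exists_powSum_const_mul {J : Set ℝ} {f : ℝ → ℝ} (K : ℝ) (hf : ∃ L, ∀ r ∈ J, f r = powSum L r) :
    ∃ L, ∀ r ∈ J, K * f r = powSum L r := by
  obtain ⟨L, h⟩ := hf
  exact ⟨L.map fun p => (K * p.1, p.2), fun r hr => by rw [h r hr, const_mul_powSum]⟩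

/-- EXISTENTIAL CLOSURE: products (on `J ⊆ (0,∞)`). -/
theorem exists_powSum_mul {J : Set ℝ} (hJ : J ⊆ Ioi 0) {f g : ℝ → ℝ} (hf : ∃ L, ∀ r ∈ J, f r = powSum L r)
    (hg : ∃ L, ∀ r ∈ J, g r = powSum L r) : ∃ L, ∀ r ∈ J, f r * g r = powSum L r := by
  obtain ⟨L₁, h₁⟩ := hf; obtain ⟨L₂, h₂⟩ := hg
  exact ⟨_, fun r hr => by rw [h₁ r hr, h₂ r hr, powSum_mul L₁ L₂ (ne_of_gt (hJ hr))]⟩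

/-- EXISTENTIAL CLOSURE: division by two. -/
theorem exists_powSum_div_two {J : Set ℝ} {f : ℝ → ℝ} (hf : ∃ L, ∀ r ∈ J, f r = powSum L r) :
    ∃ L, ∀ r ∈ J, f r / 2 = powSum L r := by
  obtain ⟨L, h⟩ := exists_powSum_const_mul (1 / 2 : ℝ) hf
  exact ⟨L, fun r hr => by rw [← h r hr]; ring⟩

/-- a monomial `K r^n` (natural exponent) is a power sum. -/
theorem exists_powSum_const_pow {J : Set ℝ} (K : ℝ) (n : ℕ) : ∃ L, ∀ r ∈ J, K * r ^ n = powSum L r :=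
  ⟨[(K, (n : ℤ))], fun r _ => by simp [powSum, zpow_natCast]⟩

/-- a monomial `K r^z` (integer exponent) is a power sum. -/
theorem exists_powSum_const_zpow {J : Set ℝ} (K : ℝ) (z : ℤ) : ∃ L, ∀ r ∈ J, K * r ^ z = powSum L r :=
  ⟨[(K, z)], fun r _ => by simp [powSum]⟩

/-- a constant is a power sum. -/
theorem exists_powSum_const {J : Set ℝ} (K : ℝ) : ∃ L, ∀ r ∈ J, K = powSum L r :=
  ⟨[(K, 0)], fun r _ => by simp [powSum]⟩

/-- dividing a power sum by `r^n` (`J ⊆ (0,∞)`). -/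
theorem exists_powSum_of_pow_mul {J : Set ℝ} (hJ : J ⊆ Ioi 0) {f : ℝ → ℝ} (n : ℕ)
    (hf : ∃ L, ∀ r ∈ J, r ^ n * f r = powSum L r) : ∃ L, ∀ r ∈ J, f r = powSum L r := by
  obtain ⟨L, h⟩ := hf
  refine ⟨L.map fun p => (p.1, p.2 + -(n : ℤ)), fun r hr => ?_⟩
  have hr0 : r ≠ 0 := ne_of_gt (hJ hr)
  rw [← powSum_mul_zpow L _ hr0, ← h r hr, zpow_neg, zpow_natCast]
  field_simp

/-- ★ A POWER SUM ON AN OPEN `J ⊆ (0,∞)` IS KILLED BY AN INTEGER EULER PRODUCT. -/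
theorem exists_eulerL_kill_of_powSum {J : Set ℝ} (hJo : IsOpen J) (hJ : J ⊆ Ioi 0) {f : ℝ → ℝ}
    (hf : ∃ L, ∀ r ∈ J, f r = powSum L r) :
    ∃ zs : List ℤ, EqOn (eulerL (zs.map (Int.cast : ℤ → ℝ)) f) 0 J := by
  obtain ⟨L, h⟩ := hf
  refine ⟨L.map fun p => -p.2, ?_⟩
  have hcongr := eulerL_congr_eqOn hJo (fun r hr => h r hr) ((L.map fun p => -p.2).map (Int.cast : ℤ → ℝ))
  intro r hr
  rw [hcongr hr]
  have hlist : ((L.map fun p => -p.2).map (Int.cast : ℤ → ℝ)) = L.map fun p => -((p.2 : ℤ) : ℝ) := by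
    rw [List.map_map]; congr 1; funext p; simp
  rw [hlist]
  exact eulerL_powSum_eq_zero L (hJ hr)

/-- ★ THE PLATEAU FORM: where the vorticity amplitude vanishes on an interval `(a,b) ⊆ (0,∞)`, the profile and its first two
derivatives are explicit integer power sums: `H = A + B r^{−2l−1}`, `H′ = −(2l+1)B r^{−2l−2}`, `H″ = (2l+1)(2l+2)B r^{−2l−3}`. -/
theorem plateau_form (hl : 1 ≤ l) (hh : ContDiff ℝ ∞ h) (hHh : ∀ r : ℝ, 0 ≤ r → H r = h (r ^ 2)) {a b : ℝ} (ha : 0 < a)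
    (hK : ∀ r ∈ Ioo a b, vortAmpL l H r = 0) :
    ∃ A B : ℝ, (∀ r ∈ Ioo a b, H r = A + B * r ^ (-((2 * l + 1 : ℕ) : ℤ))) ∧
      (∀ r ∈ Ioo a b, deriv H r = -((2 * l + 1 : ℕ) : ℝ) * B * r ^ (-((2 * l + 1 : ℕ) : ℤ) - 1)) ∧
      (∀ r ∈ Ioo a b, deriv (deriv H) r =
        ((2 * l + 1 : ℕ) : ℝ) * (((2 * l + 1 : ℕ) : ℝ) + 1) * B * r ^ (-((2 * l + 1 : ℕ) : ℤ) - 1 - 1)) := by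
  have hHc : ContDiffOn ℝ ∞ H (Ioi 0) := contDiffOn_profile_Ioi hh hHh
  have hH'c : ContDiffOn ℝ ∞ (deriv H) (Ioi 0) := hHc.deriv_of_isOpen isOpen_Ioi (by simp)
  -- `(r^{2l+2} H')' = 0`
  have hf : ∀ r ∈ Ioo a b, HasDerivAt (fun x : ℝ => x ^ (2 * l + 2) * deriv H x) 0 r := by
    intro r hr
    have hr0 : 0 < r := ha.trans hr.1
    have h1 := hasDerivAt_pow_mul hH'c (2 * l + 2) hr0
    rw [show 2 * l + 2 - 1 = 2 * l + 1 by omega] at h1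
    refine h1.congr_deriv ?_
    have hKr := hK r hr
    unfold vortAmpL at hKr
    have hr0' : r ≠ 0 := hr0.ne'
    have hKr' : r * deriv (deriv H) r + 2 * ((l : ℝ) + 1) * deriv H r = 0 := by
      have hh2 := hKr
      field_simp at hh2
      linear_combination hh2
    have e : r ^ (2 * l + 2) = r ^ (2 * l + 1) * r := pow_succ r (2 * l + 1)
    rw [e]
    push_cast
    linear_combination r ^ (2 * l + 1) * hKr'
  have hfd : DifferentiableOn ℝ (fun x : ℝ => x ^ (2 * l + 2) * deriv H x) (Ioo a b) :=
    fun r hr => (hf r hr).differentiableAt.differentiableWithinAt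
  obtain ⟨k, hk⟩ := isOpen_Ioo.exists_is_const_of_deriv_eq_zero isPreconnected_Ioo hfd (fun r hr => (hf r hr).deriv)
  have hHd : DifferentiableOn ℝ H (Ioo a b) := (hHc.differentiableOn (by simp)).mono fun r hr => ha.trans hr.1
  set m : ℕ := 2 * l + 1 with hm
  set B : ℝ := -k / (2 * l + 1) with hB
  set g : ℝ → ℝ := fun r => B * r ^ (-(m : ℤ)) with hg
  have hder : ∀ r ∈ Ioo a b, deriv H r = k * (r ^ (2 * l + 2))⁻¹ := by
    intro r hr
    have hr0 : r ≠ 0 := ne_of_gt (ha.trans hr.1)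
    have h := hk r hr
    have hpow : r ^ (2 * l + 2) ≠ 0 := pow_ne_zero _ hr0
    field_simp
    linear_combination h
  have hgder : ∀ r ∈ Ioo a b, HasDerivAt g (k * (r ^ (2 * l + 2))⁻¹) r := by
    intro r hr
    have hr0 : r ≠ 0 := ne_of_gt (ha.trans hr.1)
    have h1 := (hasDerivAt_zpow (-(m : ℤ)) r (Or.inl hr0)).const_mul B
    refine h1.congr_deriv ?_
    have e : r ^ (-(m : ℤ) - 1) = (r ^ (2 * l + 2))⁻¹ := by
      rw [show (-(m : ℤ) - 1) = -((2 * l + 2 : ℕ) : ℤ) by rw [hm]; push_cast; ring, zpow_neg, zpow_natCast]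
    rw [e, hB, hm]
    have h2l1 : (2 * (l : ℝ) + 1) ≠ 0 := by positivity
    push_cast
    field_simp
  have hgd : DifferentiableOn ℝ g (Ioo a b) := fun r hr => (hgder r hr).differentiableAt.differentiableWithinAt
  obtain ⟨A, hA⟩ := isOpen_Ioo.exists_eq_add_of_deriv_eq isPreconnected_Ioo hHd hgd (fun r hr => by
    rw [(hgder r hr).deriv, hder r hr])
  refine ⟨A, B, fun r hr => by rw [hA hr]; simp only [hg]; ring, fun r hr => ?_, fun r hr => ?_⟩
  · have hr0 : r ≠ 0 := ne_of_gt (ha.trans hr.1)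
    rw [hder r hr]
    have e : r ^ (-(m : ℤ) - 1) = (r ^ (2 * l + 2))⁻¹ := by
      rw [show (-(m : ℤ) - 1) = -((2 * l + 2 : ℕ) : ℤ) by rw [hm]; push_cast; ring, zpow_neg, zpow_natCast]
    rw [e, hB]
    have h2l1 : (2 * (l : ℝ) + 1) ≠ 0 := by positivity
    simp only [hm]
    push_cast
    field_simp
  · -- second derivative: differentiate the first-derivative formula on the open interval
    have hr0 : r ≠ 0 := ne_of_gt (ha.trans hr.1)
    have hev : deriv H =ᶠ[𝓝 r] fun x => -(m : ℝ) * B * x ^ (-(m : ℤ) - 1) := by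
      filter_upwards [Ioo_mem_nhds hr.1 hr.2] with x hx
      have hx0 : x ≠ 0 := ne_of_gt (ha.trans hx.1)
      rw [hder x hx]
      have e : x ^ (-(m : ℤ) - 1) = (x ^ (2 * l + 2))⁻¹ := by
        rw [show (-(m : ℤ) - 1) = -((2 * l + 2 : ℕ) : ℤ) by rw [hm]; push_cast; ring, zpow_neg, zpow_natCast]
      rw [e, hB]
      have h2l1 : (2 * (l : ℝ) + 1) ≠ 0 := by positivity
      simp only [hm]
      push_cast
      field_simp
    rw [hev.deriv_eq]
    have h1 := (hasDerivAt_zpow (-(m : ℤ) - 1) r (Or.inl hr0)).const_mul (-(m : ℝ) * B)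
    rw [h1.deriv]
    push_cast
    ring

/-- on a plateau, `H`, `H′`, `H″` are power sums. -/
theorem plateau_powSums (hl : 1 ≤ l) (hh : ContDiff ℝ ∞ h) (hHh : ∀ r : ℝ, 0 ≤ r → H r = h (r ^ 2)) {a b : ℝ} (ha : 0 < a)
    (hK : ∀ r ∈ Ioo a b, vortAmpL l H r = 0) :
    (∃ L, ∀ r ∈ Ioo a b, H r = powSum L r) ∧ (∃ L, ∀ r ∈ Ioo a b, deriv H r = powSum L r) ∧
      (∃ L, ∀ r ∈ Ioo a b, deriv (deriv H) r = powSum L r) := by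
  obtain ⟨A, B, h0, h1, h2⟩ := plateau_form hl hh hHh ha hK
  refine ⟨⟨[(A, 0), (B, -((2 * l + 1 : ℕ) : ℤ))], fun r hr => by rw [h0 r hr]; simp [powSum]⟩,
    ⟨[(-((2 * l + 1 : ℕ) : ℝ) * B, -((2 * l + 1 : ℕ) : ℤ) - 1)], fun r hr => by rw [h1 r hr]; simp [powSum]⟩,
    ⟨[(((2 * l + 1 : ℕ) : ℝ) * (((2 * l + 1 : ℕ) : ℝ) + 1) * B, -((2 * l + 1 : ℕ) : ℤ) - 1 - 1)], fun r hr => by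
      rw [h2 r hr]; simp [powSum]⟩⟩

/-- on a plateau the SCALED JET quantities are power sums. -/
theorem plateau_jet_powSums (hl : 1 ≤ l) (hh : ContDiff ℝ ∞ h) (hHh : ∀ r : ℝ, 0 ≤ r → H r = h (r ^ 2)) {a b : ℝ} (ha : 0 < a)
    (hK : ∀ r ∈ Ioo a b, vortAmpL l H r = 0) :
    (∃ L, ∀ r ∈ Ioo a b, r ^ (l + 3) * deriv H r + ((l : ℝ) + 1) * (r ^ (l + 2) * H r) = powSum L r) ∧
    (∃ L, ∀ r ∈ Ioo a b, (r ^ (l + 4) * deriv (deriv H) r + ((l : ℝ) + 2) * (r ^ (l + 3) * deriv H r)) / 2 = powSum L r) ∧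
    (∃ L, ∀ r ∈ Ioo a b, (l : ℝ) * (r ^ (l + 3) * deriv H r) = powSum L r) ∧
    (∃ L, ∀ r ∈ Ioo a b, (l : ℝ) * (r ^ (l + 4) * deriv (deriv H) r - r ^ (l + 3) * deriv H r) / 2 = powSum L r) := by
  have hJ : Ioo a b ⊆ Ioi 0 := fun r hr => ha.trans hr.1
  obtain ⟨hH, hH', hH''⟩ := plateau_powSums hl hh hHh ha hK
  have p3 : ∃ L, ∀ r ∈ Ioo a b, r ^ (l + 3) * deriv H r = powSum L r :=
    exists_powSum_mul hJ (by simpa using exists_powSum_const_pow (J := Ioo a b) 1 (l + 3)) hH'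
  have p2 : ∃ L, ∀ r ∈ Ioo a b, r ^ (l + 2) * H r = powSum L r :=
    exists_powSum_mul hJ (by simpa using exists_powSum_const_pow (J := Ioo a b) 1 (l + 2)) hH
  have p4 : ∃ L, ∀ r ∈ Ioo a b, r ^ (l + 4) * deriv (deriv H) r = powSum L r :=
    exists_powSum_mul hJ (by simpa using exists_powSum_const_pow (J := Ioo a b) 1 (l + 4)) hH''
  refine ⟨exists_powSum_add p3 (exists_powSum_const_mul _ p2),
    exists_powSum_div_two (exists_powSum_add p4 (exists_powSum_const_mul _ p3)),
    exists_powSum_const_mul _ p3,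
    ?_⟩
  obtain ⟨L, hL⟩ := exists_powSum_const_mul (l : ℝ) (exists_powSum_sub p4 p3)
  exact exists_powSum_div_two ⟨L, hL⟩

/-- ★ ON A PLATEAU THE THREE SOURCE CHANNELS (read at `s = r²`) ARE INTEGER POWER SUMS IN `r`. -/
theorem plateau_channels_powSums (hl : 1 ≤ l) (hh : ContDiff ℝ ∞ h) (hHh : ∀ r : ℝ, 0 ≤ r → H r = h (r ^ 2)) {a b : ℝ}
    (ha : 0 < a) (hK : ∀ r ∈ Ioo a b, vortAmpL l H r = 0) :
    (∃ L, ∀ r ∈ Ioo a b, chanY l h (r ^ 2) = powSum L r) ∧ (∃ L, ∀ r ∈ Ioo a b, chanG l h (r ^ 2) = powSum L r) ∧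
      (∃ L, ∀ r ∈ Ioo a b, ampA l h (r ^ 2) ^ 2 = powSum L r) := by
  have hJ : Ioo a b ⊆ Ioi 0 := fun r hr => ha.trans hr.1
  obtain ⟨pA, pA', pB, pB'⟩ := plateau_jet_powSums hl hh hHh ha hK
  refine ⟨?_, ?_, ?_⟩
  · apply exists_powSum_of_pow_mul hJ (2 * l + 8)
    obtain ⟨L, hL⟩ := exists_powSum_add (exists_powSum_sub (exists_powSum_sub (exists_powSum_add (exists_powSum_add
      (exists_powSum_const_mul (4 * (l : ℝ) ^ 2) (exists_powSum_mul hJ pA' pA'))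
      (exists_powSum_const_mul 4 (exists_powSum_mul hJ pB' pB')))
      (exists_powSum_const_mul ((l : ℝ) ^ 2 + 2 * l + 3) (exists_powSum_mul hJ pB pB)))
      (exists_powSum_const_mul (8 * (l : ℝ)) (exists_powSum_mul hJ pA' pB')))
      (exists_powSum_const_mul (4 * (l : ℝ)) (exists_powSum_mul hJ pA' pB)))
      (exists_powSum_sub (exists_powSum_const_mul (4 * ((l : ℝ) + 1)) (exists_powSum_mul hJ pB pB'))
        (exists_powSum_const_mul (4 * (l : ℝ) * ((l : ℝ) - 1)) (exists_powSum_mul hJ pA pB')))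
    refine ⟨L, fun r hr => ?_⟩
    rw [chanY_sq_scaled hh hHh l (hJ hr), ← hL r hr]
    ring
  · apply exists_powSum_of_pow_mul hJ (2 * l + 6)
    obtain ⟨L, hL⟩ := exists_powSum_sub (exists_powSum_sub
      (exists_powSum_const_mul (4 * ((l : ℝ) - 1)) (exists_powSum_mul hJ pA pA'))
      (exists_powSum_const_mul 4 (exists_powSum_mul hJ pA' pB)))
      (exists_powSum_const_mul (2 * ((l : ℝ) - 1)) (exists_powSum_mul hJ pA pB))
    refine ⟨L, fun r hr => ?_⟩
    rw [chanG_sq_scaled hh hHh l (hJ hr), ← hL r hr]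
  · apply exists_powSum_of_pow_mul hJ (2 * l + 4)
    obtain ⟨L, hL⟩ := exists_powSum_mul hJ pA pA
    exact ⟨L, fun r hr => by rw [ampA_sq_scaled hh hHh l (hJ hr), ← hL r hr]⟩

/-- ★ ON A PLATEAU EVERY SOURCE LEVEL (read at `s = r²`) IS KILLED BY AN INTEGER EULER PRODUCT. -/
theorem plateau_cascadeSrc_killed (hl : 1 ≤ l) (hh : ContDiff ℝ ∞ h) (hHh : ∀ r : ℝ, 0 ≤ r → H r = h (r ^ 2)) {a b : ℝ}
    (ha : 0 < a) (hK : ∀ r ∈ Ioo a b, vortAmpL l H r = 0) (k : ℕ) :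
    ∃ zs : List ℤ, EqOn (eulerL (zs.map (Int.cast : ℤ → ℝ)) (fun r => cascadeSrc l h k (r ^ 2))) 0 (Ioo a b) := by
  have hJ : Ioo a b ⊆ Ioi 0 := fun r hr => ha.trans hr.1
  obtain ⟨pY, pG, pA⟩ := plateau_channels_powSums hl hh hHh ha hK
  apply exists_eulerL_kill_of_powSum isOpen_Ioo hJ
  match k with
  | 0 => exact pY
  | 1 =>
    obtain ⟨L, hL⟩ := exists_powSum_div_two pG
    exact ⟨L, fun r hr => by show chanG l h (r ^ 2) / 2 = _; exact hL r hr⟩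
  | 2 =>
    obtain ⟨L, hL⟩ := exists_powSum_const_mul (1 / 4 : ℝ) pA
    exact ⟨L, fun r hr => by show ampA l h (r ^ 2) ^ 2 / 4 = _; rw [← hL r hr]; ring⟩
  | k + 3 => exact ⟨[], fun r hr => by show (0 : ℝ) = _; simp [powSum]⟩

end Plateau

end Summit.NavierStokesRegularity.NavierStokesRegularity.Theorems.UnthreadedRigidity.VirialHorn
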